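import Literature.NumberTheory.PAdicHodge.FontaineDpst
import Literature.NumberTheory.GaloisRepresentations.FramedRepTwist
import HarnessLib

/-!
# Labelled Hodge–Tate weight of the determinant of a de Rham representation, for THE pinned
# Fontaine data (one named schema)

Topic `NumberTheory/PAdicHodge`; story of the accepted `FontainePstLabelledWeightsSchemata`
(`LabelledWeightsRestrictSchema`, `LabelledWeightsTwistSchema`).  One NAMED FACT (D-0014):

* `LabelledWeightsDetSchema` — for a de Rham `ρ : Γ_K → GL_n(ℚ̄_ℓ)` and a `ℚ_ℓ`-label
  `τ : K → ℚ̄_ℓ`, the rank-one representation `det ρ · 1` has the single `τ`-labelled Hodge–Tate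
  weight `Σ HT_τ(ρ)`: `HT_τ(det ρ) = {Σ HT_τ(ρ)}`.  Fontaine: `D_dR` is an exact, faithful
  `⊗`-functor on de Rham representations commuting with exterior powers, so
  `D_dR(det V) = det D_dR(V)` with the induced filtration, whose unique jump on the `τ`-component is
  the sum of the jumps of `D_dR(V)_τ` (Exp. III §1.5, Prop. 1.5.2; Brinon–Conrad §6.3).  The tree
  PROVES the inertial shadow of this statement for CRYSTALLINE `ρ` over a degree-one base as clause
  (F12) `CrystallineDetOnInertia` (`det ρ|_{I_K} = ε^{-Σ HT_τ(ρ)}`), and the rank-one cases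
  `HT_τ(ε^m) = {-m}` (`CyclotomicPowersLabelledWeightsBdR`) unconditionally.

Like its two accepted siblings this is a statement about Fontaine's functor for THE pinned datum
`fontainePst K ℓ hK` which is a theorem for Fontaine's construction and becomes a
theorem-by-construction at step D2 of the Upgrade path of `FontaineDpst`.  Wanted by the crux
`stmt-Langlands-17000` (`NonParallelVoid.TwistedInductionParallel`, line `symmetrise-pd-split`, stub 3
`stub_potentialAutomorphyOfInducedTwist`): the two weight pairs of the symmetrised twist
`W = ρ|_E ⊗ χ` above one label of `K` are CONCENTRIC because `det W = θ|_E` descends to `K`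
(`HT(det W)` at both labels of `E` above a label `τ` of `K` equals `HT_τ(θ)`).

## References

* [FontaineAsterisque223III] J.-M. Fontaine, *Représentations p-adiques semi-stables*, Astérisque 223
  (1994), Exp. III §1.5 (Prop. 1.5.2: the category of `B`-admissible representations is stable
  under `⊗`, duals, sub-objects and quotients, and `D_B` is an exact faithful `⊗`-functor on it).
* [BrinonConrad2009] O. Brinon, B. Conrad, *CMI Summer School notes on p-adic Hodge theory* (2009),
  §6.3 (filtered `⊗`-compatibility of `D_dR`), §9.1 p. 133 and Prop. 9.1.11 (crystalline case).
* [Patrikis2019] S. Patrikis, *Variations on a theorem of Tate*, Mem. AMS 258 (2019), §2.7.1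
  (labelled Hodge–Tate weights and their functorialities).

`lean search 'LabelledWeightsDetSchema|labelledHodgeTateWeights_det'` (2026-08-17): no prior
declaration; nearest proved neighbours `CrystallineDetOnInertia.det_eq_of_labelledHodgeTateWeights_eq`
(inertial shadow, crystalline, degree one), `fontainePst_labelledHodgeTateWeights_of_cyclotomic_zpow`.
-/

noncomputable section

open Field ValuativeRel
open Literature.NumberTheory.GaloisRepresentations

namespace Literature.NumberTheory.PAdicHodge

/-- **The determinant of a de Rham representation has labelled Hodge–Tate weight the sum of the
labelled weights, for THE pinned Fontaine datum**: for an `ℓ`-adic local field `K`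
(`hK : |ℓ|_K < 1`), a framed `ρ : Γ_K → GL_n(ℚ̄_ℓ)` de Rham for `fontainePst K ℓ hK` and a
`ℚ_ℓ`-label `τ : K → ℚ̄_ℓ`, the rank-one framed representation `det ρ · 1`
(`(FramedRep.scalar ℚ̄_ℓ 1).comp (FramedRep.det ρ)`) has `HT_τ(det ρ · 1) = {Σ HT_τ(ρ)}`.
Fontaine, Exp. III Prop. 1.5.2: `D_dR` is an exact faithful `⊗`-functor on de Rham representations,
so `D_dR(Λⁿ V) = Λⁿ D_dR(V)` as filtered modules, read on `τ`-components; Brinon–Conrad §6.3.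
The tree proves the inertial shadow for crystalline `ρ` over a degree-one base (clause (F12),
`CrystallineDetOnInertia`). [cite: FontaineAsterisque223III, Exp. III §1.5, Prop. 1.5.2]
[cite: BrinonConrad2009, §6.3] [cite: Patrikis2019, §2.7.1] -/
def LabelledWeightsDetSchema : Prop :=
  ∀ (ℓ : ℕ) [Fact ℓ.Prime] (K : Type) [Field K] [ValuativeRel K] [TopologicalSpace K]
    [IsNonarchimedeanLocalField K] [CharZero K] (hK : valuation K (ℓ : K) < 1) (n : ℕ)
    (ρ : FramedRep (absoluteGaloisGroup K) (PadicAlgCl ℓ) n),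
    (fontainePst K ℓ hK).IsDeRhamFramed ρ →
    letI := (fontainePst K ℓ hK).algebra
    ∀ τ : K →ₐ[ℚ_[ℓ]] PadicAlgCl ℓ,
      (fontainePst K ℓ hK).𝔅.labelledHodgeTateWeights
          (FramedRep.toContinuousRep
            ((FramedRep.scalar (PadicAlgCl ℓ) 1).comp (FramedRep.det ρ))) τ.toRingHom =
        {((fontainePst K ℓ hK).𝔅.labelledHodgeTateWeights (FramedRep.toContinuousRep ρ)
            τ.toRingHom).sum}

end Literature.NumberTheory.PAdicHodge

end
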